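import Summits.BirchSwinnertonDyer.Rank1Residual.X2.GreenbergVatsalTateDatumTorsion
import Summits.BirchSwinnertonDyer.Rank1Residual.X2.GreenbergVatsalStrictSelmerMultiplicative
import Summits.BirchSwinnertonDyer.Rank1Residual.Iwasawa.TateParametrisationUnits
import Literature.NumberTheory.EllipticCurves.TateCurve.NumberFieldUniformization
import Literature.NumberTheory.EllipticCurves.KummerSelmerStructure
import Literature.NumberTheory.EllipticCurves.SubgroupSelmer
import HarnessLib

/-!
# `δ = 1 ⇒ a ≥ 1` at a SPLIT multiplicative prime: a rational point of order `p` gives a local class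
# of order `p` in `ker(H¹(ℚ_p, E) → H¹(ℚ_{∞,π}, E))` — the input `hξ` of the a-term socket
# `Theorems/EisensteinPrimesX2GeneratorCountAtP` (route `EisensteinPrimes`, line `mudescent`, stub
# `stub_lambdaCount_offLocus`, ALGEBRAIC side; seat bsd-eis-lam-b g2, PROGRAMME PART 1b seat (5))

HONEST FRAMING (cell `bsd-eis`; no tranche here proves BSD): THEOREMS ONLY — no definition, no named
fact, nothing asserted about any particular curve, closes nothing, moves no label. The étale end `W₀`
of a type-A multiplicative class with trivial even character (`φ = 𝟙`) CARRIES a rational point `P`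
of order `p`, and `p ∣ #E(ℚ)_tors` forces `p` SPLIT (tree `X2.TorsionForcesSplit`). This file proves
that then Greenberg's local kernel at `π ∣ p` is non-zero, in the exact currency of the socket:

* `exists_cocycle_of_fixed_torsion` — for ANY `ℤ_p`-extension `κ` and place `v`, the continuous
  crossed homomorphism `σ ↦ χ(σ)·P̃` on `Γ_{ℚ_v}` (`χ = κ ∘ res mod p`, `P̃ ∈ E[p]` a `Γ_ℚ`-fixed point)
  with values in `E[p]`;
* `X2.exists_localKernelClass_of_split_of_fixed_torsion` — at a SPLIT multiplicative `p` (`p`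
  odd), for a non-zero `Γ_ℚ`-fixed `P̃ ∈ E[p]` (the image of a rational point of order `p`), a place
  `v ∋ p` and a CYCLOTOMIC `κ`: the class
  `ξ = θ[σ ↦ χ(σ)·P̃] ∈ H¹(Γ_{ℚ_v}, E(ℚ̄_v))` is non-zero, killed by `p`, in the image of
  `H¹(ℚ_v, E[p])`, and restricts to `0` on `Gal(ℚ̄_v/ℚ_{∞,π})` (there `χ ≡ 0`).

WHY `ξ ≠ 0` (Tate): by the PUBLISHED split Tate uniformisation (Silverman *ATAEC* V.3.1/V.5.3, tree
fact `Silverman1994_thmV53_tateUniformisation`, DISCHARGED: `TateCurve.…_holds`) `E(ℚ̄_v) = ℚ̄_vˣ/q^ℤ`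
equivariantly, `0 < |q|_v < 1`. If `χ(σ)·P = σR − R` for some `R = Φ(u)`, `P = Φ(w)`, then
`σu = u·w^{χ(σ)}·q^{a_σ}` and `w^p = q^b`; the Galois-invariant spectral valuation (n1011's
`TateUnits.specVal_units_map`, `zpow_specVal_injective`) gives `b·χ(σ) + p·a_σ = 0`. If `p ∤ b` then
`χ ≡ 0 (mod p)` on `Γ_{ℚ_v}` — absurd, the inertia group at `p` maps ONTO `Gal(ℚ_∞/ℚ)`
(`X2.GreenbergVatsalStrictAtPQuotient.exists_mem_inertia_kappa_eq`); if `p ∣ b` then `P = Φ(ζ)` with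
`ζ^p = 1`, and an inertia element with cyclotomic character `2` (`p` odd;
`X2.GreenbergVatsalTateDatumTorsion.exists_mem_absInertia_cyclotomicCharacter_eq_natCast`) maps `P`
to `2P` — absurd for a RATIONAL `P ≠ 0`. (Equivalently: `q ∈ (ℚ_pˣ)^p`, i.e. Greenberg's
`ord_p log_p q_E ≥ 2`, LNM 1716 pp. 91–93, `|ker r_π| ∼ log_p(q_E)/2p ≥ p`.)

References: [GreenbergLNM1716] §3 pp. 91–93 (ker r_v at a split v ∣ p), §5 pp. 114–118;
[SilvermanATAEC1994] V.3.1 (c),(d), V.5.3; [GreenbergVatsal2000] §2 pp. 14–15; X1R0-GAPMAP §14.1 (a);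
HOME/b2b-bsdres-eisenstein-p2/routeT/README.md («a = 1 iff ord_p log_p q_E ≥ 2»).
-/

set_option autoImplicit false
-- `Summit.BirchSwinnertonDyer.BirchSwinnertonDyer.…`: the summit and its single sub-problem share a name (D-0017 layout).
set_option linter.dupNamespace false

noncomputable section

open Function Field NumberField IsDedekindDomain WeierstrassCurve
  Literature.NumberTheory.EllipticCurves Literature.NumberTheory.GaloisRepresentations
  Literature.NumberTheory.EllipticCurves.GreenbergSelmer
  Summit.BirchSwinnertonDyer.Rank1Residual
  Summit.BirchSwinnertonDyer.Rank1Residual.Iwasawa.TateUnits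
  Summit.BirchSwinnertonDyer.Rank1Residual.X2.GreenbergVatsalReductionDatum

namespace Summit.BirchSwinnertonDyer.BirchSwinnertonDyer.Theorems.EisensteinPrimesX2SplitTorsionLocalKernelClass

variable {W : WeierstrassCurve ℚ} [W.IsElliptic] {p : ℕ} [hp : Fact p.Prime]

/-! ## §1. The crossed homomorphism `σ ↦ χ(σ)·P̃` on `Γ_{ℚ_v}` -/

omit [W.IsElliptic] in
/-- **The cocycle `σ ↦ χ(σ)·P̃`.** For a `ℤ_p`-extension `κ` of `ℚ`, a finite place `v`, and a
`Γ_ℚ`-fixed `P̃ ∈ E[p]`: the map `σ ↦ (κ(res σ) mod p)·P̃` is a continuous crossed homomorphism on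
`Γ_{ℚ_v}` with values in `E[p]|_{Γ_{ℚ_v}}` (`Γ_{ℚ_v}` fixes `P̃`, and `p·P̃ = 0`). Stated as an
existence with its values, so that no definition is introduced. [folklore] -/
theorem exists_cocycle_of_fixed_torsion (κ : ZpExtension ℚ p) (v : HeightOneSpectrum (𝓞 ℚ))
    (Pt : geomTorsion W (p : ℤ)) (hPt : ∀ σ : absoluteGaloisGroup ℚ, σ • Pt = Pt) :
    ∃ φ : contOneCocycles (DiscreteGaloisModule.toTopRep
        ((W.torsionGaloisModule (p : ℤ)).restrictField (v.adicCompletion ℚ))),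
      ∀ σ, φ.1 σ = (PadicInt.toZModPow 1 (Multiplicative.toAdd
        (κ (resGal (K := ℚ) (v.adicCompletion ℚ) σ)))).val • Pt := by
  -- the character `n = κ ∘ res mod p`
  let n : absoluteGaloisGroup (v.adicCompletion ℚ) → ZMod (p ^ 1) := fun σ ↦
    PadicInt.toZModPow 1 (Multiplicative.toAdd (κ (resGal (K := ℚ) (v.adicCompletion ℚ) σ)))
  have hn_cont : Continuous n :=
    (PadicInt.continuous_toZModPow p 1).comp (continuous_toAdd.comp
      (κ.toContinuousMonoidHom.comp (resGal (K := ℚ) (v.adicCompletion ℚ))).continuous)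
  have hn_mul : ∀ g h, n (g * h) = n g + n h := fun g h ↦ by
    simp only [n, map_mul, toAdd_mul, map_add]
  have hpPt : p • Pt = 0 := Subtype.ext (by
    rw [AddSubgroupClass.coe_nsmul, ZeroMemClass.coe_zero]
    exact AddSubgroup.torsionBy.nsmul_iff.mp Pt.2)
  -- `k • P̃` only depends on `k mod p`
  have hpPt' : p ^ 1 • Pt = 0 := by rw [pow_one]; exact hpPt
  have key : ∀ m : ℕ, (m % p ^ 1) • Pt = m • Pt := fun m ↦ (nsmul_eq_mod_nsmul m hpPt').symm
  have hval : ∀ a b : ZMod (p ^ 1), (a + b).val • Pt = a.val • Pt + b.val • Pt := fun a b ↦ by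
    rw [ZMod.val_add, key, add_nsmul]
  refine ⟨⟨⟨fun σ ↦ (n σ).val • Pt,
    (continuous_of_discreteTopology (f := fun x : ZMod (p ^ 1) ↦ x.val • Pt)).comp hn_cont⟩,
    fun g h ↦ ?_⟩, fun σ ↦ rfl⟩
  change (n (g * h)).val • Pt = (n g).val • Pt + resGal (K := ℚ) (v.adicCompletion ℚ) g • ((n h).val • Pt)
  rw [smul_comm, hPt, hn_mul, hval]

/-! ## §2. At a SPLIT multiplicative `p`: the class is a non-zero element of `ker r_π` of order `p` -/

/-- **`δ = 1 ⇒ a ≥ 1` at a split multiplicative prime.** `E/ℚ` elliptic, `p` odd of SPLIT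
multiplicative reduction, `P̃ ∈ E[p]` non-zero and `Γ_ℚ`-fixed (a rational point of order `p`), `v ∋ p`,
`κ` THE cyclotomic `ℤ_p`-extension.
Then there is `ξ ∈ H¹(Γ_{ℚ_v}, E(ℚ̄_v))` with `ξ ≠ 0`, `p • ξ = 0`, `ξ` in the image of
`H¹(ℚ_v, E[p])`, and `res ξ = 0` on `Gal(ℚ̄_v/ℚ_{∞,π})` — namely `ξ = θ[σ ↦ χ(σ)·P̃]` (§1); it is
an element of order `p` of Greenberg's `ker(r_π)`, i.e. the hypothesis `hξ` of
`EisensteinPrimesX2GeneratorCountAtP` (a-term `a ≥ 1`). Non-vanishing: Tate uniformisation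
(PUBLISHED, tree `_holds`) + the Galois-invariant spectral valuation; see the module docstring.
[cite: GreenbergLNM1716, §3 pp. 91–93] [cite: SilvermanATAEC1994, Ch. V Thm. 3.1 (c),(d), Thm. 5.3] -/
theorem X2.exists_localKernelClass_of_split_of_fixed_torsion (hp2 : p ≠ 2)
    (hsplit : W.HasSplitMultiplicativeReductionAtPrime p)
    (Pt : geomTorsion W (p : ℤ)) (hPt : ∀ σ : absoluteGaloisGroup ℚ, σ • Pt = Pt) (hPt0 : Pt ≠ 0)
    (v : HeightOneSpectrum (𝓞 ℚ)) (hpv : ((p : ℕ) : 𝓞 ℚ) ∈ v.asIdeal)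
    (κ : ZpExtension ℚ p) (hκ : κ.IsCyclotomic) :
    ∃ ξ : galoisCohomology (W.localGaloisModule (v.adicCompletion ℚ)) 1, ξ ≠ 0 ∧ p • ξ = 0 ∧
      ξ ∈ (galoisCohomology.map (W.torsionPointsMapIntertwining (p : ℤ) (v.adicCompletion ℚ)) 1).range ∧
      resH1Hom (Literature.NumberTheory.EllipticCurves.subgroupIncl
          (localSubgroup κ.kerSubgroup (v.adicCompletion ℚ)))
        (AddMonoidHom.id (localPoints W (v.adicCompletion ℚ))) (fun _ _ ↦ rfl) ξ = 0 := by
  -- notation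
  set Kv := v.adicCompletion ℚ with hKv
  -- the local image `P_loc ∈ E(ℚ̄_v)` of the `Γ_ℚ`-fixed `p`-torsion point `P̃ ∈ E[p]`
  have hpPg : p • (Pt : geomPoints W) = 0 := AddSubgroup.torsionBy.nsmul_iff.mp Pt.2
  have hPt0' : (Pt : geomPoints W) ≠ 0 := fun h ↦ hPt0 (Subtype.ext h)
  set Ploc : localPoints W Kv := pointsMap W Kv (Pt : geomPoints W) with hPloc
  have hPloc0 : Ploc ≠ 0 := fun h ↦ hPt0' (pointsMapOfEmb_injective W (closureEmb (K := ℚ) Kv) (by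
    rw [map_zero]; exact h))
  have hPloc_fix : ∀ σ : absoluteGaloisGroup Kv, σ • Ploc = Ploc := fun σ ↦ by
    rw [hPloc, ← pointsMap_smul W Kv σ (Pt : geomPoints W)]
    congr 1
    exact congrArg Subtype.val (hPt (resGal (K := ℚ) Kv σ))
  have hpPloc : p • Ploc = 0 := by
    have h := congrArg (pointsMap W Kv) hpPg
    rwa [map_nsmul, map_zero] at h
  -- the cocycle and its classes
  obtain ⟨φ, hφ⟩ := exists_cocycle_of_fixed_torsion κ v Pt hPt
  let c : galoisCohomology ((W.torsionGaloisModule (p : ℤ)).restrictField Kv) 1 :=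
    oneCocycleClass _ φ
  refine ⟨galoisCohomology.map (W.torsionPointsMapIntertwining (p : ℤ) Kv) 1 c, ?_, ?_, ⟨c, rfl⟩, ?_⟩
  · -- `ξ ≠ 0`: the Tate-uniformisation / spectral-valuation argument
    intro hξ0
    -- (1) unpack `ξ = 0`: the pushed cocycle is a coboundary `g ↦ g•R − R` in `E(ℚ̄_v)`
    rw [W.map_torsionPointsMapIntertwining_oneCocycleClass (p : ℤ) Kv φ] at hξ0
    obtain ⟨R, hR⟩ := (oneCocycleClass_eq_zero_iff _ _).mp hξ0
    set nn : absoluteGaloisGroup Kv → ℕ := fun g ↦ (PadicInt.toZModPow 1 (Multiplicative.toAdd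
      (κ (resGal (K := ℚ) Kv g)))).val with hnn
    have hnn_lt : ∀ g, nn g < p := fun g ↦ by
      have h := ZMod.val_lt (PadicInt.toZModPow 1 (Multiplicative.toAdd (κ (resGal (K := ℚ) Kv g))))
      exact lt_of_lt_of_eq h (pow_one p)
    have hR' : ∀ g : absoluteGaloisGroup Kv, nn g • Ploc = g • R - R := fun g ↦ by
      have h := hR g
      rw [contOneCocycles.pullback_apply] at h
      change (W.torsionPointsMapIntertwining (p : ℤ) Kv) (φ.1 g) = g • R - R at h
      rw [hφ, map_nsmul, torsionPointsMapIntertwining_apply] at h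
      exact h
    -- (2) the split Tate uniformisation at `v` (PUBLISHED, Silverman V.3.1/V.5.3; tree `_holds`)
    obtain ⟨q, Φ, hq0, hq1, hsurj, hker, hΦσ, -⟩ :=
      TateCurve.Silverman1994_thmV53_tateUniformisation_holds W v
        (X2.GreenbergVatsalStrictSelmerMultiplicative.hasSplitMultiplicativeReductionAt_of_mem W p hsplit
          hpv)
    set qh : AlgebraicClosure Kv := algebraMap Kv (AlgebraicClosure Kv) q with hqh
    obtain ⟨hVq0, hVq1⟩ := specVal_algebraMap_pos_lt_one (v := v) hq0 hq1
    obtain ⟨aR, haR⟩ := hsurj R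
    obtain ⟨aP, haP⟩ := hsurj Ploc
    set wR := Additive.toMul aR with hwR
    set wP := Additive.toMul aP with hwP
    have hΦR : Φ (Additive.ofMul wR) = R := by rw [hwR, ofMul_toMul]; exact haR
    have hΦP : Φ (Additive.ofMul wP) = Ploc := by rw [hwP, ofMul_toMul]; exact haP
    -- valuations of units are non-zero
    have hVne : ∀ u : (AlgebraicClosure Kv)ˣ, specVal v (u : AlgebraicClosure Kv) ≠ 0 := fun u ↦
      (Valuation.ne_zero_iff _).mpr u.ne_zero
    -- (3) `w_P^p = q^b`
    have hPp : Φ (Additive.ofMul (wP ^ p)) = 0 := by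
      rw [ofMul_pow, map_nsmul, hΦP, hpPloc]
    obtain ⟨b, hb⟩ := (hker (wP ^ p)).mp hPp
    have hVb : specVal v (wP : AlgebraicClosure Kv) ^ (p : ℤ) = specVal v qh ^ b := by
      rw [zpow_natCast, ← map_pow, ← Units.val_pow_eq_pow_val, hb, map_zpow₀]
    -- (4) for each `g`: `σ w_R = q^{a} · w_R · w_P^{n g}`, hence `b·n g + p·a = 0`
    have hrel : ∀ g : absoluteGaloisGroup Kv, ∃ a : ℤ, b * (nn g : ℤ) + p * a = 0 := by
      intro g
      have h0 : Φ (Additive.ofMul ((Units.map (Field.absoluteGaloisGroup.toAlgEquiv Kv g :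
          AlgebraicClosure Kv →* AlgebraicClosure Kv) wR) * (wR * wP ^ nn g)⁻¹)) = 0 := by
        rw [ofMul_mul, ofMul_inv, ofMul_mul, ofMul_pow, map_add, map_neg, map_add, map_nsmul,
          ← hΦσ g wR, hΦR, hΦP, hR' g]
        abel
      obtain ⟨a, ha⟩ := (hker _).mp h0
      refine ⟨a, ?_⟩
      -- apply the Galois-invariant valuation
      have hV := congrArg (specVal v) ha
      rw [Units.val_mul, Units.val_inv_eq_inv_val, Units.val_mul, Units.val_pow_eq_pow_val, map_mul,
        map_inv₀, map_mul, map_pow, specVal_units_map, map_zpow₀] at hV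
      -- `hV : V wR * (V wR * V wP ^ nn g)⁻¹ = V q ^ a`
      have hV' : specVal v (wP : AlgebraicClosure Kv) ^ (nn g : ℤ) * specVal v qh ^ a = 1 := by
        have h1 := hVne wR
        have h2 := pow_ne_zero (nn g) (hVne wP)
        rw [← hV, zpow_natCast]
        field_simp
      have e1 : specVal v qh ^ (b * (nn g : ℤ)) =
          (specVal v (wP : AlgebraicClosure Kv) ^ (nn g : ℤ)) ^ (p : ℤ) := by
        rw [zpow_mul, ← hVb, ← zpow_mul, ← zpow_mul, mul_comm]
      have e2 : specVal v qh ^ ((p : ℤ) * a) = (specVal v qh ^ a) ^ (p : ℤ) := by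
        rw [mul_comm, zpow_mul]
      have hV'' : specVal v qh ^ (b * (nn g : ℤ) + p * a) = specVal v qh ^ (0 : ℤ) := by
        rw [zpow_zero, zpow_add₀ hVq0.ne', e1, e2, ← mul_zpow, hV', one_zpow]
      exact zpow_specVal_injective hq0 hq1 hV''
    -- (5) case analysis on `p ∣ b`
    have hpZ : Prime (p : ℤ) := Nat.prime_iff_prime_int.mp hp.out
    by_cases hpb : (p : ℤ) ∣ b
    · -- `p ∣ b`: `P_loc = Φ(ζ)` with `ζ^p = 1`, and inertia moves it (`χ_cyc(σ₀) = 2`, `p` odd)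
      obtain ⟨b', rfl⟩ := hpb
      have hqh0 : qh ≠ 0 := (map_ne_zero_iff _ (FaithfulSMul.algebraMap_injective _ _)).mpr hq0
      set ζ : (AlgebraicClosure Kv)ˣ := wP * (Units.mk0 qh hqh0) ^ (-b') with hζ
      have hζp : (ζ : AlgebraicClosure Kv) ^ p = 1 := by
        rw [hζ, Units.val_mul, Units.val_zpow_eq_zpow_val, Units.val_mk0, mul_pow,
          ← Units.val_pow_eq_pow_val, hb, ← zpow_natCast (qh ^ (-b')), ← zpow_mul, ← zpow_add₀ hqh0,
          show (p : ℤ) * b' + -b' * (p : ℕ) = 0 by ring, zpow_zero]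
      have hΦζ : Φ (Additive.ofMul ζ) = Ploc := by
        have hq1' : Φ (Additive.ofMul (Units.mk0 qh hqh0)) = 0 :=
          (hker _).mpr ⟨1, by rw [Units.val_mk0, zpow_one]⟩
        rw [hζ, ofMul_mul, ofMul_zpow, map_add, map_zsmul, hq1', smul_zero, add_zero, hΦP]
      -- an inertia element with cyclotomic character `2`
      have hpp : 2 < p := lt_of_le_of_ne hp.out.two_le (Ne.symm hp2)
      obtain ⟨σ₀, -, hχ⟩ :=
        X2.GreenbergVatsalTateDatumTorsion.exists_mem_absInertia_cyclotomicCharacter_eq_natCast p hpv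
          (N := 2) (fun h ↦ hp2 ((Nat.prime_dvd_prime_iff_eq hp.out Nat.prime_two).mp h))
      haveI : NeZero ((p : ℕ) : Kv) := ⟨by
        rw [← map_natCast (algebraMap ℚ Kv)]
        exact (map_ne_zero_iff _ (algebraMap ℚ Kv).injective).mpr (Nat.cast_ne_zero.mpr hp.out.ne_zero)⟩
      have hζp' : (ζ : AlgebraicClosure Kv) ^ p ^ 1 = 1 := by rw [pow_one]; exact hζp
      have hσζ : σ₀ • (ζ : AlgebraicClosure Kv) = (ζ : AlgebraicClosure Kv) ^ 2 := by
        rw [GaloisRep.cyclotomicCharacter_spec Kv p σ₀ _ hζp', hχ, map_natCast, ZMod.val_natCast,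
          pow_one, Nat.mod_eq_of_lt hpp]
      have hunit : Units.map (Field.absoluteGaloisGroup.toAlgEquiv Kv σ₀ :
          AlgebraicClosure Kv →* AlgebraicClosure Kv) ζ = ζ ^ 2 := by
        ext
        rw [Units.coe_map, MonoidHom.coe_coe, ← Field.absoluteGaloisGroup.smul_def, hσζ,
          Units.val_pow_eq_pow_val]
      have h2 : (2 : ℕ) • Ploc = Ploc := by
        conv_rhs => rw [← hPloc_fix σ₀, ← hΦζ, hΦσ σ₀ ζ, hunit, ofMul_pow, map_nsmul]
        rw [hΦζ]
      rw [two_nsmul] at h2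
      exact hPloc0 (by simpa using h2)
    · -- `p ∤ b`: then `n ≡ 0` on `Γ_{ℚ_v}`, but inertia at `p` maps ONTO `Gal(ℚ_∞/ℚ)`
      have hnn0 : ∀ g, nn g = 0 := fun g ↦ by
        obtain ⟨a, ha⟩ := hrel g
        have hdvd : (p : ℤ) ∣ b * (nn g : ℤ) := ⟨-a, by linear_combination ha⟩
        rcases hpZ.dvd_or_dvd hdvd with h | h
        · exact absurd h hpb
        · exact Nat.eq_zero_of_dvd_of_lt (Int.natCast_dvd_natCast.mp h) (hnn_lt g)
      obtain ⟨y, hy, hκy⟩ := X2.GreenbergVatsalStrictAtPQuotient.exists_mem_inertia_kappa_eq κ v hκ hpv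
        (Multiplicative.ofAdd 1)
      obtain ⟨σ, -, rfl⟩ := Subgroup.mem_map.mp hy
      have h1 := hnn0 σ
      rw [hnn] at h1
      change (PadicInt.toZModPow 1 (Multiplicative.toAdd (κ (absGaloisRestrict ℚ Kv σ)))).val = 0 at h1
      rw [show ((absGaloisRestrict ℚ Kv).toMonoidHom σ) = absGaloisRestrict ℚ Kv σ from rfl] at hκy
      rw [hκy, toAdd_ofAdd, map_one, ZMod.val_eq_zero] at h1
      haveI : Fact (1 < p ^ 1) := ⟨by rw [pow_one]; exact hp.out.one_lt⟩
      exact one_ne_zero h1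
  · -- `p • c = [p • φ] = 0` since `(p • φ)(σ) = χ(σ)·(p·P̃) = 0`
    have hpPt : p • Pt = 0 := Subtype.ext (by
      rw [AddSubgroupClass.coe_nsmul, ZeroMemClass.coe_zero]
      exact AddSubgroup.torsionBy.nsmul_iff.mp Pt.2)
    have hpφ : p • φ = 0 := by
      apply Subtype.ext
      apply ContinuousMap.ext
      intro σ
      change p • φ.1 σ = 0
      rw [hφ σ, smul_comm, hpPt, smul_zero]
    have hc0 : p • c = 0 := by
      change p • oneCocycleClassₗ _ φ = 0
      rw [← map_nsmul, hpφ, map_zero]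
    rw [← map_nsmul, hc0, map_zero]
  · -- on `Gal(ℚ̄_v/ℚ_{∞,π})` the character vanishes, so the restricted cocycle is `0`
    rw [W.map_torsionPointsMapIntertwining_oneCocycleClass (p : ℤ) Kv φ]
    set ψ := contOneCocycles.pullback (ContinuousMonoidHom.id (absoluteGaloisGroup Kv))
        (X := DiscreteGaloisModule.toTopRep (GaloisRep.restrictField Kv (W.torsionGaloisModule (p : ℤ))))
        (Y := discreteTopRep (absoluteGaloisGroup Kv) (localPoints W Kv))
        (TopRep.ofHom ⟨(W.torsionPointsMapIntertwining (p : ℤ) Kv).toContinuousLinearMap,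
          (W.torsionPointsMapIntertwining (p : ℤ) Kv).isIntertwining'⟩) φ with hψ
    have key : resH1Hom (Literature.NumberTheory.EllipticCurves.subgroupIncl (localSubgroup κ.kerSubgroup Kv))
        (AddMonoidHom.id (localPoints W Kv)) (fun _ _ ↦ rfl)
        (oneCocycleClass (discreteTopRep (absoluteGaloisGroup Kv) (localPoints W Kv)) ψ) =
        oneCocycleClass _ (contOneCocycles.pullback (Literature.NumberTheory.EllipticCurves.subgroupIncl (localSubgroup κ.kerSubgroup Kv))
          (resHomOfEquivariant (Literature.NumberTheory.EllipticCurves.subgroupIncl (localSubgroup κ.kerSubgroup Kv))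
            (AddMonoidHom.id (localPoints W Kv)) (fun _ _ ↦ rfl)) ψ) :=
      map_oneCocycleClass _ _ _ ψ
    rw [key, oneCocycleClass_eq_zero_iff]
    refine ⟨0, fun g ↦ ?_⟩
    have hg : κ (resGal (K := ℚ) Kv (g : absoluteGaloisGroup Kv)) = 1 := by
      rw [← ZpExtension.mem_kerSubgroup]
      exact (mem_localSubgroup_iff κ.kerSubgroup Kv g).mp g.2
    rw [contOneCocycles.pullback_apply, hψ, contOneCocycles.pullback_apply, map_zero, sub_zero]
    change (W.torsionPointsMapIntertwining (p : ℤ) Kv) (φ.1 (g : absoluteGaloisGroup Kv)) = 0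
    rw [hφ, hg, toAdd_one, map_zero, ZMod.val_zero, zero_smul, map_zero]

end Summit.BirchSwinnertonDyer.BirchSwinnertonDyer.Theorems.EisensteinPrimesX2SplitTorsionLocalKernelClass

end
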